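import Mathlib.Analysis.Analytic.IteratedFDeriv
import Mathlib.Analysis.Calculus.IteratedDeriv.Defs
import Mathlib.Analysis.Complex.Basic
import HarnessLib

/-!
# Directional jets versus mixed derivatives: polarization for analytic maps

Topic: `Literature/NumberTheory/Transcendental`. Plan item W4/S5(b) of the unit
`provefact-Literature.NumberTheory.Transcendental.H-b596640137`. The vanishing conditions of
Baker's method (`GaGmE.Std.VanishesAlong 𝔟 F w N`, `PhilipponZeroEstimateStd.lean`) are stated
through ONE-variable jets `d^k/dt^k F(w + t x)|₀` along all directions `x ∈ 𝔟`. The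
extrapolation argument needs the vanishing of all MIXED derivatives `D^kF(w)(x₁, …, x_k)`,
`xᵢ ∈ 𝔟`. PROVED here, for maps on a normed space over a field of characteristic zero:

* `iteratedDeriv_line_eq_iteratedFDeriv` — `d^k/dt^k F(w + t x)|₀ = D^kF(w)(x, …, x)` for `C^k`
  maps (composition with the affine line, `ContinuousLinearMap.iteratedFDeriv_comp_right`);
* `MultilinearMap.polarization` — the **polarization identity**
  `∑_{S ⊆ [k]} (-1)^{k-|S|} M(∑_{i∈S} vᵢ, …, ∑_{i∈S} vᵢ) = ∑_{σ ∈ 𝔖_k} M(v_{σ 1}, …, v_{σ k})`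
  (inclusion–exclusion), for ANY multilinear map `M`;
* `eq_zero_of_symmetric_of_diagonal` — a SYMMETRIC `k`-linear map vanishing on the diagonal of a
  submodule `V` vanishes on `V^k`;
* `iteratedFDeriv_eq_zero_of_lineJets` — for an analytic (`C^ω`) map `F`, if all line jets of
  orders `< N` along directions in `V` vanish at `w`, then `D^kF(w)` vanishes on `V^k` for
  `k < N` (symmetry of `D^kF`: Mathlib's `ContDiffAt.iteratedFDeriv_comp_perm`).

## References

* A. Baker, G. Wüstholz, *Logarithmic Forms and Diophantine Geometry*, CUP 2007, §6.8 (p. 119).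
-/

noncomputable section

open scoped ContDiff
open Finset

namespace Literature.NumberTheory.Transcendental

/-! ### Line jets are diagonal values of the iterated derivative -/

section Line

variable {𝕜 : Type*} [NontriviallyNormedField 𝕜] {E F : Type*} [NormedAddCommGroup E]
  [NormedSpace 𝕜 E] [NormedAddCommGroup F] [NormedSpace 𝕜 F]

/-- **Line jets.** For a `C^n` map and `k ≤ n`:
`d^k/dt^k F(w + t•x)|_{t=0} = D^kF(w)(x, …, x)`. [folklore] -/
theorem iteratedDeriv_line_eq_iteratedFDeriv {f : E → F} {n : WithTop ℕ∞} (hf : ContDiff 𝕜 n f)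
    (w x : E) {k : ℕ} (hk : (k : WithTop ℕ∞) ≤ n) :
    iteratedDeriv k (fun t : 𝕜 => f (w + t • x)) 0 = iteratedFDeriv 𝕜 k f w fun _ => x := by
  set ℓ : 𝕜 →L[𝕜] E := ContinuousLinearMap.toSpanSingleton 𝕜 x with hℓ
  have hfw : ContDiff 𝕜 n (fun z : E => f (w + z)) := hf.comp (contDiff_const.add contDiff_id)
  have e1 : (fun t : 𝕜 => f (w + t • x)) = (fun z : E => f (w + z)) ∘ ℓ := by
    funext t; simp [hℓ, ContinuousLinearMap.toSpanSingleton_apply]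
  rw [iteratedDeriv_eq_iteratedFDeriv, e1, ℓ.iteratedFDeriv_comp_right hfw 0 hk,
    ContinuousMultilinearMap.compContinuousLinearMap_apply, iteratedFDeriv_comp_add_left]
  simp [hℓ, ContinuousLinearMap.toSpanSingleton_apply]

end Line

/-! ### Polarization -/

section Polarization

variable {R M N : Type*} [CommRing R] [AddCommGroup M] [Module R M] [AddCommGroup N] [Module R N]

/-- Inclusion–exclusion over supersets: `∑_{S ⊇ A} (-1)^{|Sᶜ|} = [A = univ]`. [folklore] -/
theorem sum_supersets_neg_one_pow {ι : Type*} [Fintype ι] [DecidableEq ι] (A : Finset ι) :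
    ∑ S ∈ (Finset.univ : Finset (Finset ι)).filter (fun S => A ⊆ S), (-1 : R) ^ (Sᶜ).card =
      if A = Finset.univ then 1 else 0 := by
  -- reindex supersets of `A` by subsets of `Aᶜ`: `S ↦ S \\ A`, `(Sᶜ).card = (Aᶜ).card - (S \\ A).card`
  have key : ∑ S ∈ (Finset.univ : Finset (Finset ι)).filter (fun S => A ⊆ S), (-1 : R) ^ (Sᶜ).card =
      ∑ B ∈ (Aᶜ).powerset, (-1 : R) ^ ((Aᶜ).card - B.card) := by
    refine Finset.sum_nbij' (fun S => S \ A) (fun B => B ∪ A) ?_ ?_ ?_ ?_ ?_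
    · intro S hS
      simp only [Finset.mem_powerset]
      intro i hi
      simp only [Finset.mem_sdiff] at hi
      exact Finset.mem_compl.mpr hi.2
    · intro B hB
      simp only [Finset.mem_filter, Finset.mem_univ, true_and]
      exact Finset.subset_union_right
    · intro S hS
      simp only [Finset.mem_filter, Finset.mem_univ, true_and] at hS
      exact Finset.sdiff_union_of_subset hS
    · intro B hB
      simp only [Finset.mem_powerset] at hB
      rw [Finset.union_sdiff_right]
      exact Finset.sdiff_eq_self_of_disjoint (Finset.disjoint_left.mpr fun i hiB hiA =>
        (Finset.mem_compl.mp (hB hiB)) hiA)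
    · intro S hS
      simp only [Finset.mem_filter, Finset.mem_univ, true_and] at hS
      congr 1
      have h1 : (S \ A).card = S.card - A.card := Finset.card_sdiff_of_subset hS
      have h2 : (Sᶜ).card = Fintype.card ι - S.card := Finset.card_compl S
      have h3 : (Aᶜ).card = Fintype.card ι - A.card := Finset.card_compl A
      have h4 : A.card ≤ S.card := Finset.card_le_card hS
      have h5 : S.card ≤ Fintype.card ι := Finset.card_le_univ S
      omega
  rw [key]
  set n := (Aᶜ).card with hn
  have hterm : ∀ B ∈ (Aᶜ).powerset, (-1 : R) ^ (n - B.card) = (-1) ^ n * (-1) ^ B.card := by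
    intro B hB
    have hle : B.card ≤ n := Finset.card_le_card (Finset.mem_powerset.mp hB)
    have hsq : (-1 : R) ^ B.card * (-1) ^ B.card = 1 := by
      rw [← pow_add, ← two_mul, pow_mul]; simp
    calc (-1 : R) ^ (n - B.card) = (-1) ^ (n - B.card) * ((-1) ^ B.card * (-1) ^ B.card) := by
          rw [hsq, mul_one]
      _ = (-1) ^ n * (-1) ^ B.card := by
          rw [← mul_assoc, ← pow_add, Nat.sub_add_cancel hle]
  rw [Finset.sum_congr rfl hterm, ← Finset.mul_sum]
  have hcast : (∑ B ∈ (Aᶜ).powerset, (-1 : R) ^ B.card) =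
      ((∑ B ∈ (Aᶜ).powerset, (-1 : ℤ) ^ B.card : ℤ) : R) := by push_cast; rfl
  rw [hcast, Finset.sum_powerset_neg_one_pow_card]
  by_cases hA : A = Finset.univ
  · have h0 : Aᶜ = ∅ := by simp [hA]
    have hn0 : n = 0 := by simp [hn, h0]
    simp [hA, hn0]
  · have h0 : Aᶜ ≠ ∅ := by
      intro h; exact hA (by simpa using h)
    simp [hA, h0]

/-- **Polarization identity** for an arbitrary multilinear map:
`∑_{S ⊆ [k]} (-1)^{|Sᶜ|} M(∑_{i∈S} vᵢ, …, ∑_{i∈S} vᵢ) = ∑_{σ ∈ 𝔖_k} M(v ∘ σ)`. [folklore] -/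
theorem MultilinearMap.polarization {k : ℕ} (Mm : MultilinearMap R (fun _ : Fin k => M) N)
    (v : Fin k → M) :
    ∑ S : Finset (Fin k), (-1 : R) ^ (Sᶜ).card • Mm (fun _ => ∑ i ∈ S, v i) =
      ∑ σ : Equiv.Perm (Fin k), Mm (fun j => v (σ j)) := by
  classical
  -- expand each diagonal term over maps `f : Fin k → S`
  have hexp : ∀ S : Finset (Fin k), Mm (fun _ => ∑ i ∈ S, v i) =
      ∑ f ∈ Fintype.piFinset (fun _ : Fin k => S), Mm (fun j => v (f j)) := by
    intro S
    exact MultilinearMap.map_sum_finset Mm (fun _ i => v i) (fun _ => S)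
  simp_rw [hexp, Finset.smul_sum]
  -- swap the sums: over all `f`, then over `S ⊇ image f`
  have hswap : ∑ S : Finset (Fin k), ∑ f ∈ Fintype.piFinset (fun _ : Fin k => S),
      (-1 : R) ^ (Sᶜ).card • Mm (fun j => v (f j)) =
      ∑ f : Fin k → Fin k, ∑ S ∈ (Finset.univ : Finset (Finset (Fin k))).filter
        (fun S => Finset.univ.image f ⊆ S), (-1 : R) ^ (Sᶜ).card • Mm (fun j => v (f j)) := by
    refine Finset.sum_comm' fun S f => ?_
    simp only [Finset.mem_univ, true_and, Fintype.mem_piFinset, Finset.mem_filter, and_true]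
    constructor
    · intro h i hi
      obtain ⟨j, -, rfl⟩ := Finset.mem_image.mp hi
      exact h j
    · intro h j
      exact h (Finset.mem_image_of_mem f (Finset.mem_univ j))
  rw [hswap]
  -- inner sums by inclusion–exclusion
  have hinner : ∀ f : Fin k → Fin k, ∑ S ∈ (Finset.univ : Finset (Finset (Fin k))).filter
      (fun S => Finset.univ.image f ⊆ S), (-1 : R) ^ (Sᶜ).card • Mm (fun j => v (f j)) =
      if Finset.univ.image f = Finset.univ then Mm (fun j => v (f j)) else 0 := by
    intro f
    rw [← Finset.sum_smul, sum_supersets_neg_one_pow]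
    split_ifs <;> simp
  simp_rw [hinner]
  rw [Finset.sum_ite, Finset.sum_const_zero, add_zero]
  -- surjective self-maps of `Fin k` are the permutations
  have hset : (Finset.univ : Finset (Fin k → Fin k)).filter (fun f => Finset.univ.image f = Finset.univ) =
      (Finset.univ : Finset (Equiv.Perm (Fin k))).image (fun σ : Equiv.Perm (Fin k) => (⇑σ : Fin k → Fin k)) := by
    ext f
    simp only [Finset.mem_filter, Finset.mem_univ, true_and, Finset.mem_image]
    constructor
    · intro hf
      have hsurj : Function.Surjective f := fun y => by
        have : y ∈ Finset.univ.image f := by rw [hf]; exact Finset.mem_univ y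
        obtain ⟨x, -, hx⟩ := Finset.mem_image.mp this
        exact ⟨x, hx⟩
      have hbij : Function.Bijective f := ⟨Finite.injective_iff_surjective.mpr hsurj, hsurj⟩
      exact ⟨Equiv.ofBijective f hbij, rfl⟩
    · rintro ⟨σ, rfl⟩
      exact Finset.eq_univ_of_forall fun y =>
        Finset.mem_image.mpr ⟨σ.symm y, Finset.mem_univ _, σ.apply_symm_apply y⟩
  rw [hset, Finset.sum_image fun (σ : Equiv.Perm (Fin k)) _ (τ : Equiv.Perm (Fin k)) _
    (h : (⇑σ : Fin k → Fin k) = ⇑τ) => Equiv.coe_fn_injective h]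

/-- **A symmetric multilinear map vanishing on the diagonal of a subspace vanishes on its powers**
(over a field of characteristic zero). [folklore] -/
theorem eq_zero_of_symmetric_of_diagonal {K V W : Type*} [Field K] [CharZero K] [AddCommGroup V]
    [Module K V] [AddCommGroup W] [Module K W] {k : ℕ} (Mm : MultilinearMap K (fun _ : Fin k => V) W)
    (hsymm : ∀ (σ : Equiv.Perm (Fin k)) (v : Fin k → V), Mm (fun j => v (σ j)) = Mm v)
    (U : Submodule K V) (hdiag : ∀ u ∈ U, Mm (fun _ => u) = 0) (v : Fin k → V) (hv : ∀ i, v i ∈ U) :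
    Mm v = 0 := by
  classical
  have hpol := MultilinearMap.polarization Mm v
  have hL : ∑ S : Finset (Fin k), (-1 : K) ^ (Sᶜ).card • Mm (fun _ => ∑ i ∈ S, v i) = 0 :=
    Finset.sum_eq_zero fun S _ => by rw [hdiag _ (U.sum_mem fun i _ => hv i), smul_zero]
  have hR : ∑ σ : Equiv.Perm (Fin k), Mm (fun j => v (σ j)) = (Nat.factorial k : K) • Mm v := by
    rw [Finset.sum_congr rfl fun σ _ => hsymm σ v, Finset.sum_const, Finset.card_univ,
      Fintype.card_perm, Fintype.card_fin, ← Nat.cast_smul_eq_nsmul K]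
  rw [hL, hR] at hpol
  have hk : (Nat.factorial k : K) ≠ 0 := by exact_mod_cast Nat.factorial_ne_zero k
  exact (smul_eq_zero.mp hpol.symm).resolve_left hk

end Polarization

/-! ### From line jets to mixed derivatives for analytic maps -/

section Analytic

variable {E F : Type*} [NormedAddCommGroup E] [NormedSpace ℂ E] [NormedAddCommGroup F] [NormedSpace ℂ F]

/-- **Line jets control mixed derivatives.** For a `C^ω` map `f`, a subspace `U` of directions, a
point `w` and an order `N`: if all line jets `d^k/dt^k f(w + t x)|₀`, `x ∈ U`, `k < N`, vanish, then
`D^kf(w)(x₁, …, x_k) = 0` for all `k < N` and `xᵢ ∈ U` (symmetry of `D^kf(w)` for analytic maps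
and polarization). [folklore] -/
theorem iteratedFDeriv_eq_zero_of_lineJets {f : E → F} (hf : ContDiff ℂ ω f) (U : Submodule ℂ E)
    (w : E) (N : ℕ) (h : ∀ x ∈ U, ∀ k < N, iteratedDeriv k (fun t : ℂ => f (w + t • x)) 0 = 0)
    {k : ℕ} (hk : k < N) (m : Fin k → E) (hm : ∀ i, m i ∈ U) :
    iteratedFDeriv ℂ k f w m = 0 := by
  have hsymm : ∀ (σ : Equiv.Perm (Fin k)) (v : Fin k → E),
      (iteratedFDeriv ℂ k f w).toMultilinearMap (fun j => v (σ j)) = (iteratedFDeriv ℂ k f w).toMultilinearMap v :=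
    fun σ v => hf.contDiffAt.iteratedFDeriv_comp_perm v σ
  have hdiag : ∀ u ∈ U, (iteratedFDeriv ℂ k f w).toMultilinearMap (fun _ => u) = 0 := by
    intro u hu
    have := h u hu k hk
    rwa [iteratedDeriv_line_eq_iteratedFDeriv hf w u (le_top : (k : WithTop ℕ∞) ≤ ω)] at this
  exact eq_zero_of_symmetric_of_diagonal _ hsymm U hdiag m hm

end Analytic

end Literature.NumberTheory.Transcendental

end
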